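import Summits.Ventures.HodgeRepro2.T5InertDegreeCompletion
import Summits.Ventures.HodgeRepro2.T5InertPlaceCompletionCells
import Summits.Ventures.HodgeRepro2.T5AdicCompletionResidueField
import Summits.Ventures.HodgeRepro2.T5LocalDegreeBounds

/-!
# The degree count on the record's local fields: `deg Tₙ = (N(v)³ + 1) N(v)^{4n−3}` at an inert place
(cell pub-hodge-repro2, seat p3)

Tier-5 N3 support. Files 203 / 205 / 206 count `deg Tₙ = #(K aₙ K / K) = (q³ + 1) q^{4n−3}` for the Hecke
algebra of `U(antidiag(1, u, 1))` at an inert place, with `q = #{t ∈ 𝔽 : t + t̄ = 0}` the order of the trace-zero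
part of the residue field `𝔽` of `𝒪_{E_v}`. On Mathlib's completions `K_v ⊆ L_w` of the record's number fields
this file identifies `q` with the ABSOLUTE NORM `N(v) = #(𝓞_K / v)` of the place (the order of the residue field
of `K_v`), so that the count reads as printed, `deg Tₙ = (N(v)³ + 1) N(v)^{4n−3}`:

* `card_residueField_integralClosure` — the residue field of `𝒪_{E_v} = integralClosure O_{K_v} L_w` is that of
  `O_{L_w}` (`IsIntegralClosure.equiv`, p4's `IsIntegralClosure O_{L_w} O_{K_v} L_w`);
* `inertiaDeg'_eq_two_of_ramificationIdx'_eq_one` — `f(w/v) = 2` when `e(w/v) = 1` and `[L_w : K_v] = 2` (p8's T5-159);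
* **`card_residueField_integralClosure_eq_sq`** — `#𝔽 = N(v)²` (p4's `card_residueField`: `#𝓀(O_{L_w}) = N(w)`,
  and Mathlib's `N(w) = N(v)^{f(w/v)}`);
* **`card_traceZero_eq_absNorm`** — `q = N(v)` (file 202's `#𝔽 = q²` and `Nat.pow_left_injective`);
* **`ncard_orbit_cellU_eq_adicCompletion`** — `deg Tₙ = (N(v)³ + 1) N(v)^{4n−3}` for `n ≥ 1`;
* **`mul_cellU_eq_adicCompletion`** / **`mul_cellU_one_eq_adicCompletion`** — the tree recursion
  `T₁ T_{n+1} = T_{n+2} + (N(v) − 1) T_{n+1} + N(v)⁴ Tₙ`, `T₁² = T₂ + (N(v) − 1) T₁ + (N(v)⁴ + N(v)) T₀`.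

Hypotheses: `e(w/v) = 1`, `[L_w : K_v] = 2`, `σ ∈ Gal(L_w/K_v)` with `σ ≠ 1` and a star on `L_w` equal to `σ`
(p8's `starRingOfInvolution`), a uniformiser `ϖ` of `O_{K_v}` irreducible in `O_{L_w}`, `u ∈ O_{K_v}ˣ`; the three
Prop-valued instances on `𝒪_{E_v}` (DVR, finite residue field, fraction ring of `L_w`) are p8's T5-146 / T5-149
and Mathlib's `integralClosure.isFractionRing_of_finite_extension`, taken as instance arguments.

Mathlib + this seat's files 205 / 206 + p4's T5AdicCompletionResidueField + p8's T5-146 / T5-149 / T5-159 and their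
imports; no display; no device. §8(d): uses an L-value-free non-vanishing device: NO.
-/

namespace Summit.Ventures.HodgeRepro2.T5InertDegreeAdicCompletion

open IsDedekindDomain HeightOneSpectrum NumberField
open Summit.Ventures.HodgeRepro2.T5HermitianThreeElements Summit.Ventures.HodgeRepro2.T5UnitaryGroupForm
  Summit.Ventures.HodgeRepro2.T5UnitaryHeckeAdjoint Summit.Ventures.HodgeRepro2.T5HeckeBasisCells
  Summit.Ventures.HodgeRepro2.T5GaloisCartanThree Summit.Ventures.HodgeRepro2.T5InertUnipotentResidue
  Summit.Ventures.HodgeRepro2.T5InertResidueInvolution Summit.Ventures.HodgeRepro2.T5InertTraceLift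
  Summit.Ventures.HodgeRepro2.T5InertDegreeGalois Summit.Ventures.HodgeRepro2.T5InertDegreeCompletion
  Summit.Ventures.HodgeRepro2.T5InertPlaceCompletion Summit.Ventures.HodgeRepro2.T5InertPlaceCompletionCells
  Summit.Ventures.HodgeRepro2.T5AdicCompletionResidueField Summit.Ventures.HodgeRepro2.T5LocalDegreeBounds

section Abstract

variable {k A : Type*} [Field k] [Mul A] [Add A] [SMul k A]

/-- Replacing the scalar `q` by an equal one in a three-term recursion (a `subst`, stated once so that the
instantiations below stay in term mode). -/
theorem recursion_congr {T₁ T₂ T₃ T₄ : A} {q q' : k} (hq : q = q')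
    (h : T₁ * T₂ = T₃ + (q - 1) • T₂ + q ^ 4 • T₄) : T₁ * T₂ = T₃ + (q' - 1) • T₂ + q' ^ 4 • T₄ := by
  subst hq; exact h

/-- The same at `n = 0` (coefficient `q⁴ + q`). -/
theorem recursion_zero_congr {T₁ T₂ T₃ T₄ : A} {q q' : k} (hq : q = q')
    (h : T₁ * T₂ = T₃ + (q - 1) • T₂ + (q ^ 4 + q) • T₄) :
    T₁ * T₂ = T₃ + (q' - 1) • T₂ + (q' ^ 4 + q') • T₄ := by
  subst hq; exact h

end Abstract

section ResidueField

variable {K : Type*} [Field K] [NumberField K] (v : HeightOneSpectrum (RingOfIntegers K))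
  {L : Type*} [Field L] [NumberField L] [Algebra K L] (w : HeightOneSpectrum (RingOfIntegers L))
  [w.asIdeal.LiesOver v.asIdeal]

/-- `f(w/v) = 2` at a place with `e(w/v) = 1` and `[L_w : K_v] = 2` (p8's T5-159). -/
theorem inertiaDeg'_eq_two_of_ramificationIdx'_eq_one (he : v.asIdeal.ramificationIdx' w.asIdeal = 1)
    (h2 : Module.finrank (v.adicCompletion K) (w.adicCompletion L) = 2) :
    v.asIdeal.inertiaDeg' w.asIdeal = 2 := by
  rcases ramificationIdx'_inertiaDeg'_of_quadratic v w h2 with ⟨_, hf⟩ | ⟨he2, _⟩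
  · exact hf
  · omega

/-- `N(w) = N(v)²` at such a place. -/
theorem absNorm_eq_sq (he : v.asIdeal.ramificationIdx' w.asIdeal = 1)
    (h2 : Module.finrank (v.adicCompletion K) (w.adicCompletion L) = 2) :
    Ideal.absNorm w.asIdeal = Ideal.absNorm v.asIdeal ^ 2 := by
  rw [Ideal.absNorm_eq_pow_inertiaDeg'_of_liesOver w.asIdeal v.asIdeal v.isPrime v.ne_bot,
    inertiaDeg'_eq_two_of_ramificationIdx'_eq_one v w he h2]

variable [IsDiscreteValuationRing (integralClosure (v.adicCompletionIntegers K) (w.adicCompletion L))]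

/-- The residue field of `𝒪_{E_v} = integralClosure O_{K_v} L_w` has the order of the residue field of `O_{L_w}`. -/
theorem card_residueField_integralClosure :
    Nat.card (IsLocalRing.ResidueField (integralClosure (v.adicCompletionIntegers K) (w.adicCompletion L))) =
      Nat.card (IsLocalRing.ResidueField (w.adicCompletionIntegers L)) :=
  (Nat.card_congr (IsLocalRing.ResidueField.mapEquiv
    (IsIntegralClosure.equiv (v.adicCompletionIntegers K) (w.adicCompletionIntegers L) (w.adicCompletion L)
      (integralClosure (v.adicCompletionIntegers K) (w.adicCompletion L))).toRingEquiv).toEquiv).symm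

/-- **`#𝔽 = N(v)²`**: the residue field of `𝒪_{E_v}` at an inert place. -/
theorem card_residueField_integralClosure_eq_sq (he : v.asIdeal.ramificationIdx' w.asIdeal = 1)
    (h2 : Module.finrank (v.adicCompletion K) (w.adicCompletion L) = 2) :
    Nat.card (IsLocalRing.ResidueField (integralClosure (v.adicCompletionIntegers K) (w.adicCompletion L))) =
      Ideal.absNorm v.asIdeal ^ 2 := by
  rw [card_residueField_integralClosure, card_residueField w, absNorm_eq_sq v w he h2]

end ResidueField

section Degree

variable {K : Type*} [Field K] [NumberField K] (v : HeightOneSpectrum (RingOfIntegers K))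
  {L : Type*} [Field L] [NumberField L] [Algebra K L] (w : HeightOneSpectrum (RingOfIntegers L))
  [w.asIdeal.LiesOver v.asIdeal]
  [IsDiscreteValuationRing (integralClosure (v.adicCompletionIntegers K) (w.adicCompletion L))]
  [Finite (IsLocalRing.ResidueField (integralClosure (v.adicCompletionIntegers K) (w.adicCompletion L)))]
  [IsFractionRing (integralClosure (v.adicCompletionIntegers K) (w.adicCompletion L)) (w.adicCompletion L)]
  [StarRing (w.adicCompletion L)]
  (σ : (w.adicCompletion L) ≃ₐ[v.adicCompletion K] (w.adicCompletion L))
  (hst : ∀ x : w.adicCompletion L, star x = σ x)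
  (he : v.asIdeal.ramificationIdx' w.asIdeal = 1)
  (h2 : Module.finrank (v.adicCompletion K) (w.adicCompletion L) = 2) (hσ : σ ≠ 1)
  {ϖ : v.adicCompletionIntegers K} (hϖ : Irreducible ϖ)
  (hinert : Irreducible (algebraMap (v.adicCompletionIntegers K) (w.adicCompletionIntegers L) ϖ))

include hst he h2 hσ hϖ hinert in
/-- **`q = N(v)`**: the trace-zero part of the residue field of `𝒪_{E_v}` has `N(v)` elements. -/
theorem card_traceZero_eq_absNorm :
    Nat.card (traceZero (integralClosure (v.adicCompletionIntegers K) (w.adicCompletion L))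
      (w.adicCompletion L)) = Ideal.absNorm v.asIdeal := by
  have hunr := map_maximalIdeal_integralClosure_eq_of_irreducible v w hϖ hinert
  have hnt := hnt_of_residueConjNontrivial σ hst (residueConjNontrivial_adicCompletion v w he h2 σ hσ hinert)
  have hnt' := exists_residueStar_ne (hstar_of_star_eq σ hst) (irreducible_uniformiser hunr hϖ)
    (star_algebraMap_of_star_eq σ hst ϖ) hnt
  have hsq := card_residueField_eq_sq (hstar_of_star_eq σ hst) (irreducible_uniformiser hunr hϖ)
    (star_algebraMap_of_star_eq σ hst ϖ)
    (exists_trace_lift (hstar_of_star_eq σ hst) (irreducible_uniformiser hunr hϖ)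
      (star_algebraMap_of_star_eq σ hst ϖ) hnt') hnt'
  rw [card_residueField_integralClosure_eq_sq v w he h2] at hsq
  exact (Nat.pow_left_injective two_ne_zero hsq).symm

include hst he h2 hσ hϖ hinert in
/-- **`deg Tₙ = (N(v)³ + 1) N(v)^{4n−3}` on the record's local fields** (`n ≥ 1`). -/
theorem ncard_orbit_cellU_eq_adicCompletion (u : (v.adicCompletionIntegers K)ˣ) (n : ℕ) (hn : 1 ≤ n) :
    (MulAction.orbit (hyperspecialSubgroup (integralClosure (v.adicCompletionIntegers K) (w.adicCompletion L))
          (J3 (algebraMap (v.adicCompletionIntegers K) (w.adicCompletion L) (u : v.adicCompletionIntegers K))))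
        ((cellU (irreducible_uniformiser (map_maximalIdeal_integralClosure_eq_of_irreducible v w hϖ hinert) hϖ)
            (star_algebraMap_of_star_eq σ hst ϖ)
            (algebraMap (v.adicCompletionIntegers K) (w.adicCompletion L) (u : v.adicCompletionIntegers K)) n :
              formUnitaryGroup (J3 (algebraMap (v.adicCompletionIntegers K) (w.adicCompletion L)
                (u : v.adicCompletionIntegers K)))) :
          formUnitaryGroup (J3 (algebraMap (v.adicCompletionIntegers K) (w.adicCompletion L)
              (u : v.adicCompletionIntegers K))) ⧸
            hyperspecialSubgroup (integralClosure (v.adicCompletionIntegers K) (w.adicCompletion L))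
              (J3 (algebraMap (v.adicCompletionIntegers K) (w.adicCompletion L)
                (u : v.adicCompletionIntegers K))))).ncard =
      (Ideal.absNorm v.asIdeal ^ 3 + 1) * Ideal.absNorm v.asIdeal ^ (4 * n - 3) := by
  rw [← card_traceZero_eq_absNorm v w σ hst he h2 hσ hϖ hinert]
  exact ncard_orbit_cellU_eq_galois σ hst (map_maximalIdeal_integralClosure_eq_of_irreducible v w hϖ hinert) u hϖ
    (residueConjNontrivial_adicCompletion v w he h2 σ hσ hinert) n hn

variable (k : Type*) [Field k] [CharZero k]

include hst he h2 hσ hϖ hinert in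
/-- **The tree recursion on the record's local fields** (`n ≥ 1`, written with `n + 1`):
`T₁ · T_{n+1} = T_{n+2} + (N(v) − 1) T_{n+1} + N(v)⁴ Tₙ`. -/
theorem mul_cellU_eq_adicCompletion (u : (v.adicCompletionIntegers K)ˣ) (n : ℕ) :
    heckeBasisCells (hstar_of_star_eq σ hst)
          (algebraMap (v.adicCompletionIntegers K) (w.adicCompletion L) (u : v.adicCompletionIntegers K))
          (star_algebraMap_of_star_eq σ hst (u : v.adicCompletionIntegers K))
          (algebraMap_unit_ne_zero (F := v.adicCompletion K) u) (isInteger_algebraMap (u : v.adicCompletionIntegers K))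
          (isInteger_algebraMap_unit_inv u)
          (irreducible_uniformiser (map_maximalIdeal_integralClosure_eq_of_irreducible v w hϖ hinert) hϖ)
          (star_algebraMap_of_star_eq σ hst ϖ) k 1 *
        heckeBasisCells (hstar_of_star_eq σ hst)
          (algebraMap (v.adicCompletionIntegers K) (w.adicCompletion L) (u : v.adicCompletionIntegers K))
          (star_algebraMap_of_star_eq σ hst (u : v.adicCompletionIntegers K))
          (algebraMap_unit_ne_zero (F := v.adicCompletion K) u) (isInteger_algebraMap (u : v.adicCompletionIntegers K))
          (isInteger_algebraMap_unit_inv u)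
          (irreducible_uniformiser (map_maximalIdeal_integralClosure_eq_of_irreducible v w hϖ hinert) hϖ)
          (star_algebraMap_of_star_eq σ hst ϖ) k (n + 1 + 1) =
      heckeBasisCells (hstar_of_star_eq σ hst)
          (algebraMap (v.adicCompletionIntegers K) (w.adicCompletion L) (u : v.adicCompletionIntegers K))
          (star_algebraMap_of_star_eq σ hst (u : v.adicCompletionIntegers K))
          (algebraMap_unit_ne_zero (F := v.adicCompletion K) u) (isInteger_algebraMap (u : v.adicCompletionIntegers K))
          (isInteger_algebraMap_unit_inv u)
          (irreducible_uniformiser (map_maximalIdeal_integralClosure_eq_of_irreducible v w hϖ hinert) hϖ)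
          (star_algebraMap_of_star_eq σ hst ϖ) k (n + 1 + 1 + 1) +
        ((Ideal.absNorm v.asIdeal : k) - 1) •
          heckeBasisCells (hstar_of_star_eq σ hst)
            (algebraMap (v.adicCompletionIntegers K) (w.adicCompletion L) (u : v.adicCompletionIntegers K))
            (star_algebraMap_of_star_eq σ hst (u : v.adicCompletionIntegers K))
            (algebraMap_unit_ne_zero (F := v.adicCompletion K) u)
            (isInteger_algebraMap (u : v.adicCompletionIntegers K)) (isInteger_algebraMap_unit_inv u)
            (irreducible_uniformiser (map_maximalIdeal_integralClosure_eq_of_irreducible v w hϖ hinert) hϖ)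
            (star_algebraMap_of_star_eq σ hst ϖ) k (n + 1 + 1) +
        (Ideal.absNorm v.asIdeal : k) ^ 4 •
          heckeBasisCells (hstar_of_star_eq σ hst)
            (algebraMap (v.adicCompletionIntegers K) (w.adicCompletion L) (u : v.adicCompletionIntegers K))
            (star_algebraMap_of_star_eq σ hst (u : v.adicCompletionIntegers K))
            (algebraMap_unit_ne_zero (F := v.adicCompletion K) u)
            (isInteger_algebraMap (u : v.adicCompletionIntegers K)) (isInteger_algebraMap_unit_inv u)
            (irreducible_uniformiser (map_maximalIdeal_integralClosure_eq_of_irreducible v w hϖ hinert) hϖ)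
            (star_algebraMap_of_star_eq σ hst ϖ) k (n + 1) :=
  recursion_congr (congrArg (Nat.cast (R := k)) (card_traceZero_eq_absNorm v w σ hst he h2 hσ hϖ hinert))
    (mul_cellU_eq_galois σ hst (map_maximalIdeal_integralClosure_eq_of_irreducible v w hϖ hinert) u hϖ k
      (residueConjNontrivial_adicCompletion v w he h2 σ hσ hinert) n)

include hst he h2 hσ hϖ hinert in
/-- **The tree recursion at `n = 0` on the record's local fields**:
`T₁² = T₂ + (N(v) − 1) T₁ + (N(v)⁴ + N(v)) T₀`. -/
theorem mul_cellU_one_eq_adicCompletion (u : (v.adicCompletionIntegers K)ˣ) :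
    heckeBasisCells (hstar_of_star_eq σ hst)
          (algebraMap (v.adicCompletionIntegers K) (w.adicCompletion L) (u : v.adicCompletionIntegers K))
          (star_algebraMap_of_star_eq σ hst (u : v.adicCompletionIntegers K))
          (algebraMap_unit_ne_zero (F := v.adicCompletion K) u) (isInteger_algebraMap (u : v.adicCompletionIntegers K))
          (isInteger_algebraMap_unit_inv u)
          (irreducible_uniformiser (map_maximalIdeal_integralClosure_eq_of_irreducible v w hϖ hinert) hϖ)
          (star_algebraMap_of_star_eq σ hst ϖ) k 1 *
        heckeBasisCells (hstar_of_star_eq σ hst)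
          (algebraMap (v.adicCompletionIntegers K) (w.adicCompletion L) (u : v.adicCompletionIntegers K))
          (star_algebraMap_of_star_eq σ hst (u : v.adicCompletionIntegers K))
          (algebraMap_unit_ne_zero (F := v.adicCompletion K) u) (isInteger_algebraMap (u : v.adicCompletionIntegers K))
          (isInteger_algebraMap_unit_inv u)
          (irreducible_uniformiser (map_maximalIdeal_integralClosure_eq_of_irreducible v w hϖ hinert) hϖ)
          (star_algebraMap_of_star_eq σ hst ϖ) k (0 + 1) =
      heckeBasisCells (hstar_of_star_eq σ hst)
          (algebraMap (v.adicCompletionIntegers K) (w.adicCompletion L) (u : v.adicCompletionIntegers K))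
          (star_algebraMap_of_star_eq σ hst (u : v.adicCompletionIntegers K))
          (algebraMap_unit_ne_zero (F := v.adicCompletion K) u) (isInteger_algebraMap (u : v.adicCompletionIntegers K))
          (isInteger_algebraMap_unit_inv u)
          (irreducible_uniformiser (map_maximalIdeal_integralClosure_eq_of_irreducible v w hϖ hinert) hϖ)
          (star_algebraMap_of_star_eq σ hst ϖ) k (0 + 1 + 1) +
        ((Ideal.absNorm v.asIdeal : k) - 1) •
          heckeBasisCells (hstar_of_star_eq σ hst)
            (algebraMap (v.adicCompletionIntegers K) (w.adicCompletion L) (u : v.adicCompletionIntegers K))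
            (star_algebraMap_of_star_eq σ hst (u : v.adicCompletionIntegers K))
            (algebraMap_unit_ne_zero (F := v.adicCompletion K) u)
            (isInteger_algebraMap (u : v.adicCompletionIntegers K)) (isInteger_algebraMap_unit_inv u)
            (irreducible_uniformiser (map_maximalIdeal_integralClosure_eq_of_irreducible v w hϖ hinert) hϖ)
            (star_algebraMap_of_star_eq σ hst ϖ) k (0 + 1) +
        ((Ideal.absNorm v.asIdeal : k) ^ 4 + (Ideal.absNorm v.asIdeal : k)) •
          heckeBasisCells (hstar_of_star_eq σ hst)
            (algebraMap (v.adicCompletionIntegers K) (w.adicCompletion L) (u : v.adicCompletionIntegers K))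
            (star_algebraMap_of_star_eq σ hst (u : v.adicCompletionIntegers K))
            (algebraMap_unit_ne_zero (F := v.adicCompletion K) u)
            (isInteger_algebraMap (u : v.adicCompletionIntegers K)) (isInteger_algebraMap_unit_inv u)
            (irreducible_uniformiser (map_maximalIdeal_integralClosure_eq_of_irreducible v w hϖ hinert) hϖ)
            (star_algebraMap_of_star_eq σ hst ϖ) k 0 :=
  recursion_zero_congr (congrArg (Nat.cast (R := k)) (card_traceZero_eq_absNorm v w σ hst he h2 hσ hϖ hinert))
    (mul_cellU_one_eq_galois σ hst (map_maximalIdeal_integralClosure_eq_of_irreducible v w hϖ hinert) u hϖ k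
      (residueConjNontrivial_adicCompletion v w he h2 σ hσ hinert))

end Degree

end Summit.Ventures.HodgeRepro2.T5InertDegreeAdicCompletion
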